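import Mathlib
import HarnessLib
import Summits.NavierStokesRegularity.NavierStokesRegularity.Theorems.TaylorModelRungThreeCertificateIntervalDJetsArrayVD
import Summits.NavierStokesRegularity.NavierStokesRegularity.Theorems.TaylorModelRungThreeCertificateIntervalDJetsR2

/-!
# Crux K1b-DR (stmt-NavierStokesRegularity-23954), line `taylor-model` — certificate SOUNDNESS tooling: INTERVAL JETS, part 6 —
# ARRAY-MATERIALISED second-order remainders `r2LevelsA` (the `R2_k(D₀)` table of CERT-CONTRACT-23954-v3 §3 C2 / VECTOR-LEMMAS (D1))

Part 5 (`…IntervalDJetsR2`) proved abstractly that a family of boxes closed under the rounded interval evaluation of the remainder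
recursion (`IsR2Enclosure`, level `0 ∋ 0`) encloses `T (y+d) k − T y k − U y d k`. This part materialises it with part 2's `buildLevels`
along a state table `Ls` and a difference table `Ds` (normally `jetLevelsA …` and `diffJetLevelsA …`): `r2StepA` forms, per `m ≤ k`, the
three products `QBA Ls[m] Rs[k-m]`, `QBA Rs[m] Ls[k-m]`, `QBA Ds[m] Ds[k-m]` once and sums them per coordinate `c < n`; the initial level is
the zero box vector `zeroBoxA n`. Structural lemma `isR2Enclosure_r2LevelsA` and the enclosure theorem `mem_r2_of_r2LevelsA` over the state
levels `jetLevelsA n QBA prec Y K` and the difference levels `diffJetLevelsA n QBA prec (jetLevelsA …) D K`.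

MODEL-lattice bookkeeping only (rung TL-M3, one finite-dimensional model ODE); nothing here concerns the Navier–Stokes equations.
-/

-- the sub-problem namespace repeats the summit name by design (D-0017)
set_option linter.dupNamespace false

namespace Summit.NavierStokesRegularity.NavierStokesRegularity.Theorems.TaylorModelCert

open scoped BigOperators

namespace IntervalD

/-- The zero box vector of size `n` (every coordinate the point interval `ofInt 0`). [folklore] -/
def zeroBoxA (n : ℕ) : Array IntervalD := Array.ofFn fun _ : Fin n => ofInt 0

/-- `zeroBoxA n` has size `n`. [folklore] -/
theorem size_zeroBoxA (n : ℕ) : (zeroBoxA n).size = n := by simp only [zeroBoxA, Array.size_ofFn]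

/-- Every coordinate of `zeroBoxA n` below `n` contains `0`. [folklore] -/
theorem mem_zeroBoxA {n c : ℕ} (hc : c < n) : mem (0 : ℝ) (aget (zeroBoxA n) c) := by
  unfold zeroBoxA; rw [aget_ofFn _ hc]; exact mem_zero

/-- The REMAINDER STEP on arrays: level `k+1` of the remainder table `Rs` along the state table `Ls` and the difference table `Ds` —
the `3(k+1)` products are formed once, then summed per coordinate `c < n` and divided by `k+1` with outward rounding. [folklore] -/
def r2StepA (n : ℕ) (QBA : Array IntervalD → Array IntervalD → Array IntervalD) (prec : ℕ) (Ls Ds : Array (Array IntervalD))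
    (k : ℕ) (Rs : Array (Array IntervalD)) : Array IntervalD :=
  let prods : Array (Array IntervalD) := Array.ofFn fun m : Fin (k + 1) =>
    let P₁ := QBA (lget Ls m) (lget Rs (k - m))
    let P₂ := QBA (lget Rs m) (lget Ls (k - m))
    let P₃ := QBA (lget Ds m) (lget Ds (k - m))
    Array.ofFn fun c : Fin n => addR prec (addR prec (aget P₁ c) (aget P₂ c)) (aget P₃ c)
  Array.ofFn fun c : Fin n => divNat prec (rangeSumR prec (fun m => aget (lget prods m) c) (k + 1)) (k + 1)

/-- **Second-order remainder enclosures, materialised**: the table of the levels `0..K` (level `0` = zero boxes) along `Ls`, `Ds`.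
[folklore] -/
def r2LevelsA (n : ℕ) (QBA : Array IntervalD → Array IntervalD → Array IntervalD) (prec : ℕ) (Ls Ds : Array (Array IntervalD)) :
    ℕ → Array (Array IntervalD) :=
  buildLevels (r2StepA n QBA prec Ls Ds) (zeroBoxA n)

/-- Remainder-step outputs have size `n`. [folklore] -/
theorem size_r2StepA (n : ℕ) (QBA : Array IntervalD → Array IntervalD → Array IntervalD) (prec : ℕ)
    (Ls Ds : Array (Array IntervalD)) (k : ℕ) (Rs : Array (Array IntervalD)) : (r2StepA n QBA prec Ls Ds k Rs).size = n := by
  simp only [r2StepA, Array.size_ofFn]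

/-- **The materialised remainder levels form a second-order-remainder enclosure** along the state and difference tables
(structural). [folklore] -/
theorem isR2Enclosure_r2LevelsA (n : ℕ) (QBA : Array IntervalD → Array IntervalD → Array IntervalD) (prec K : ℕ)
    {Ls Ds : Array (Array IntervalD)} (hLs : ∀ m ≤ K, (lget Ls m).size = n) (hDs : ∀ m ≤ K, (lget Ds m).size = n) :
    IsR2Enclosure (fnField n QBA) prec K (fnLevels n Ls) (fnLevels n Ds) (fnLevels n (r2LevelsA n QBA prec Ls Ds K)) := by
  refine ⟨fun c => ?_, fun k hk c x hx => ?_⟩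
  · simp only [fnLevels]; unfold r2LevelsA; rw [lget_buildLevels_zero]; exact mem_zeroBoxA c.isLt
  have hsz : ∀ {j : ℕ}, j ≤ K → (lget (buildLevels (r2StepA n QBA prec Ls Ds) (zeroBoxA n) K) j).size = n := fun hj =>
    size_lget_buildLevels _ _ (size_zeroBoxA n) (size_r2StepA n QBA prec Ls Ds) hj
  have hlev : aget (lget (r2LevelsA n QBA prec Ls Ds K) (k + 1)) c =
      r2Step (fnField n QBA) prec (fnLevels n Ls) (fnLevels n Ds) (fnLevels n (r2LevelsA n QBA prec Ls Ds K)) k c := by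
    simp only [r2Step, fnField]
    unfold r2LevelsA
    rw [lget_buildLevels_of_le _ _ (Nat.succ_le_of_lt hk), lget_buildLevels_succ]
    simp only [r2StepA]
    rw [aget_ofFn _ c.isLt]
    congr 1
    refine rangeSumR_congr prec (k + 1) fun m hm => ?_
    have hm' : m ≤ K := by omega
    have hkm : k - m ≤ K := by omega
    have e1 : lget (buildLevels (r2StepA n QBA prec Ls Ds) (zeroBoxA n) k) m =
        lget (buildLevels (r2StepA n QBA prec Ls Ds) (zeroBoxA n) K) m := by
      rw [lget_buildLevels_of_le _ _ hm', lget_buildLevels_of_le _ _ (Nat.le_of_lt_succ hm)]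
    have e2 : lget (buildLevels (r2StepA n QBA prec Ls Ds) (zeroBoxA n) k) (k - m) =
        lget (buildLevels (r2StepA n QBA prec Ls Ds) (zeroBoxA n) K) (k - m) := by
      rw [lget_buildLevels_of_le _ _ hkm, lget_buildLevels_of_le _ _ (Nat.sub_le k m)]
    rw [lget_ofFn _ hm]
    dsimp only
    rw [aget_ofFn _ c.isLt, e1, e2, ofFn_fnLevels (hLs m hm'), ofFn_fnLevels (hLs (k - m) hkm), ofFn_fnLevels (hDs m hm'),
      ofFn_fnLevels (hDs (k - m) hkm), ofFn_fnLevels (hsz hm'), ofFn_fnLevels (hsz hkm)]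
  show mem x (aget (lget (r2LevelsA n QBA prec Ls Ds K) (k + 1)) c)
  rw [hlev]; exact hx

section SoundR2

variable {V : Type*} [AddCommGroup V] {rd : V → ℕ → ℝ} {Q : V → V → V} {n : ℕ}

/-- **The materialised remainder levels enclose the second-order remainders** `rd (T y' k) c − rd (T y k) c − rd (U y (y'−y) k) c`
for base points `y` with coordinates in `Y` and displacements `rd y' − rd y` with coordinates in `D`, along the state levels of `y` and the
difference levels; `Q` additive in each slot, `rd` additive. [folklore] -/
theorem mem_r2_of_r2LevelsA {T : V → ℕ → V} {U : V → V → ℕ → V} (hQl : ∀ a d b, Q (a + d) b = Q a b + Q d b)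
    (hQr : ∀ a b e, Q a (b + e) = Q a b + Q a e) (hrd : ∀ x z, ∀ c < n, rd (x + z) c = rd x c + rd z c)
    (hT0 : ∀ x, ∀ c < n, rd (T x 0) c = rd x c)
    (hTs : ∀ x (k : ℕ), ∀ c < n, ((k : ℝ) + 1) * rd (T x (k + 1)) c =
      ∑ i ∈ Finset.range (k + 1), rd (Q (T x i) (T x (k - i))) c)
    (hU0 : ∀ x v, ∀ c < n, rd (U x v 0) c = rd v c)
    (hUs : ∀ x v (k : ℕ), ∀ c < n, ((k : ℝ) + 1) * rd (U x v (k + 1)) c =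
      ∑ i ∈ Finset.range (k + 1), (rd (Q (T x i) (U x v (k - i))) c + rd (Q (U x v (k - i)) (T x i)) c))
    {QBA : Array IntervalD → Array IntervalD → Array IntervalD} (hQBA : IsFieldEnclosureA rd Q n QBA)
    (prec K : ℕ) {Y D : Array IntervalD} (hY : Y.size = n) (hD : D.size = n) {y y' : V}
    (hy : ∀ c < n, mem (rd y c) (aget Y c)) (hd : ∀ c < n, mem (rd y' c - rd y c) (aget D c)) :
    ∀ k ≤ K, ∀ c < n, mem (rd (T y' k) c - rd (T y k) c - rd (U y (y' - y) k) c)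
      (aget (lget (r2LevelsA n QBA prec (jetLevelsA n QBA prec Y K)
        (diffJetLevelsA n QBA prec (jetLevelsA n QBA prec Y K) D K) K) k) c) := by
  have hy' : ∀ c : Fin n, mem (rd y c) (fnLevels n (jetLevelsA n QBA prec Y K) 0 c) := fun c => by
    simp only [fnLevels]; rw [lget_jetLevelsA_zero]; exact hy c c.isLt
  have hd' : ∀ c : Fin n, mem (rd y' c - rd y c)
      (fnLevels n (diffJetLevelsA n QBA prec (jetLevelsA n QBA prec Y K) D K) 0 c) := fun c => by
    simp only [fnLevels]; unfold diffJetLevelsA; rw [lget_buildLevels_zero]; exact hd c c.isLt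
  have hLs : ∀ m ≤ K, (lget (jetLevelsA n QBA prec Y K) m).size = n := fun m hm => size_lget_jetLevelsA n QBA prec hY hm
  have hDs : ∀ m ≤ K, (lget (diffJetLevelsA n QBA prec (jetLevelsA n QBA prec Y K) D K) m).size = n := fun m hm =>
    size_lget_buildLevels _ D hD (size_diffStepA n QBA prec _) hm
  intro k hk c hc
  exact mem_r2_of_isR2Enclosure (rd := fun (x : V) (c : Fin n) => rd x c) (Q := Q) (T := T) (U := U) hQl hQr
    (fun x z c => hrd x z c c.isLt) (fun x c => hT0 x c c.isLt) (fun x k c => hTs x k c c.isLt)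
    (fun x v c => hU0 x v c c.isLt) (fun x v k c => hUs x v k c c.isLt) (isFieldEnclosure_fnField hQBA)
    (isJetEnclosure_jetLevelsA QBA prec K hY) (isDiffJetEnclosure_diffJetLevelsA n QBA prec K hLs hD)
    (isR2Enclosure_r2LevelsA n QBA prec K hLs hDs) hy' hd' k hk ⟨c, hc⟩

end SoundR2

end IntervalD

end Summit.NavierStokesRegularity.NavierStokesRegularity.Theorems.TaylorModelCert
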